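import Literature.Dynamics.Hyperbolic.AnosovDie
import Mathlib

/-!
# No Anosov die is pair-plaque submersive (`AnosovDie.not_isPairPlaqueSubmersive`)

Topic `Literature/Dynamics/Hyperbolic`; proofs only (no definition, no named fact).  The predicate
`AnosovDie.IsPairPlaqueSubmersive` of `AnosovDie.lean` ("for `m ⊗ m`-a.e. `(θ, θ′)` and EVERY `p` in
the open Lambert disc the differential at `0` of `(r, r′) ↦ F(W θ r, W θ′ r′)(p)` is onto") is FALSE
for every `D : AnosovDie`, by a topological obstruction using only the die axioms
`contDiff_die_plaque`, `measurePreserving_die`, `die_apply_of_one_le`, `die_rev`, `plaque_zero`: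
for fixed `(θ, θ′)` the maps `A_r := F(W θ r, θ′)` are a smooth family of Lebesgue-preserving
bijections of the plane, identity off the open unit disc; `G_r := A_r ∘ A_0⁻¹` has `G_0 = id` and a
`C¹` velocity `Y = ∂_r G_r|₀` vanishing off the disc which is divergence free
(`div_vel_eq_zero`: differentiate `∫ φ ∘ G_r = ∫ φ`, integrate by parts, fundamental lemma); a planar
divergence-free field vanishing off the disc vanishes somewhere inside it (`planar_divFree_zero`:
the stream function `∫_{-2}^{y} Y₁(x,t) dt` vanishes off the disc and has an interior extremum);
at `p₀ = A_0⁻¹ q*` the `r`-partial of the pair-plaque map vanishes, so its differential has rank ≤ 1.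
Consequence for consumers: `RotorGasMacroErgodic`, `RotorGasEulerLimit` (route AnosovDiceHopf) are
vacuous and `DiceConstruction` is false as typed; the intended predicate should ask submersivity for
a.e. `p` (zeros of a generic Hamiltonian field are isolated). [folklore]
-/

open MeasureTheory Set Filter Topology Metric intervalIntegral
open scoped ContDiff

namespace Literature.Dynamics.Hyperbolic

namespace AnosovDie.PairPlaqueObstruction




/-- Expansion of a vector of the plane on the standard basis. [folklore] -/
theorem repr2 (w : (EuclideanSpace ℝ (Fin 2))) : w = (w 0) • (EuclideanSpace.single (0 : Fin 2) (1 : ℝ)) + (w 1) • (EuclideanSpace.single (1 : Fin 2) (1 : ℝ)) := by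
  ext i
  fin_cases i <;> simp

section
variable (G : ℝ → (EuclideanSpace ℝ (Fin 2)) → (EuclideanSpace ℝ (Fin 2)))



variable {G}

/-- The `r`-derivative of a `C²` family `G r q`, everywhere. [folklore] -/
theorem hasDerivAt_family (hG : ContDiff ℝ 2 (fun x : ℝ × (EuclideanSpace ℝ (Fin 2)) => G x.1 x.2)) (r : ℝ) (q : (EuclideanSpace ℝ (Fin 2))) :
    HasDerivAt (fun s => G s q) (fderiv ℝ (fun x : ℝ × (EuclideanSpace ℝ (Fin 2)) => G x.1 x.2) (r, q) (1, 0)) r := by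
  have hd : DifferentiableAt ℝ (fun x : ℝ × (EuclideanSpace ℝ (Fin 2)) => G x.1 x.2) (r, q) :=
    (hG.differentiable (by norm_num)).differentiableAt
  have hc : HasDerivAt (fun s : ℝ => ((s, q) : ℝ × (EuclideanSpace ℝ (Fin 2)))) ((1 : ℝ), (0 : (EuclideanSpace ℝ (Fin 2)))) r := by
    refine HasDerivAt.prodMk (hasDerivAt_id r) (hasDerivAt_const r q) |>.congr_deriv ?_
    simp
  have := hd.hasFDerivAt.comp_hasDerivAt r hc
  simpa [Function.comp_def] using this

/-- The velocity field as a partial Fréchet derivative of the uncurried family. [folklore] -/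
theorem vel_eq (hG : ContDiff ℝ 2 (fun x : ℝ × (EuclideanSpace ℝ (Fin 2)) => G x.1 x.2)) (q : (EuclideanSpace ℝ (Fin 2))) :
    deriv (fun r => G r q) 0 = fderiv ℝ (fun x : ℝ × (EuclideanSpace ℝ (Fin 2)) => G x.1 x.2) (0, q) (1, 0) :=
  (hasDerivAt_family hG 0 q).deriv

/-- The velocity field of a `C²` family is `C¹`. [folklore] -/
theorem contDiff_vel (hG : ContDiff ℝ 2 (fun x : ℝ × (EuclideanSpace ℝ (Fin 2)) => G x.1 x.2)) : ContDiff ℝ 1 ((fun q => deriv (fun r => G r q) 0)) := by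
  have h1 : ContDiff ℝ 1 (fderiv ℝ (fun x : ℝ × (EuclideanSpace ℝ (Fin 2)) => G x.1 x.2)) :=
    hG.fderiv_right (by norm_num)
  have h2 : ContDiff ℝ 1 (fun q : (EuclideanSpace ℝ (Fin 2)) => ((0 : ℝ), q)) := contDiff_const.prodMk contDiff_id
  have h3 : ContDiff ℝ 1 (fun q : (EuclideanSpace ℝ (Fin 2)) => fderiv ℝ (fun x : ℝ × (EuclideanSpace ℝ (Fin 2)) => G x.1 x.2) ((0 : ℝ), q) (1, 0)) :=
    (h1.comp h2).clm_apply contDiff_const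
  have : (fun q => deriv (fun r => G r q) 0) = fun q : (EuclideanSpace ℝ (Fin 2)) => fderiv ℝ (fun x : ℝ × (EuclideanSpace ℝ (Fin 2)) => G x.1 x.2) ((0 : ℝ), q) (1, 0) :=
    funext fun q => vel_eq hG q
  rw [this]; exact h3

/-- Whenever the family fixes `q` at all times, the velocity vanishes at `q`. [folklore] -/
theorem vel_eq_zero_of_fix {q : (EuclideanSpace ℝ (Fin 2))} (h : ∀ r, G r q = q) : deriv (fun r => G r q) 0 = 0 := by
  simp only [h, deriv_const]

/-- **Divergence-free velocity**: a `C²` family of Lebesgue-preserving maps of the plane with `G 0 = id`, identity off the closed unit disc, has divergence-free velocity (weak formulation by differentiating `∫ φ ∘ G r = ∫ φ` at `r = 0`, integration by parts for line derivatives, fundamental lemma of the calculus of variations, continuity). [folklore] -/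
theorem div2_vel_eq_zero (hG : ContDiff ℝ 2 (fun x : ℝ × (EuclideanSpace ℝ (Fin 2)) => G x.1 x.2))
    (h0 : ∀ q, G 0 q = q) (hfix : ∀ r q, 1 ≤ ‖q‖ → G r q = q)
    (hmp : ∀ r, MeasurePreserving (G r) volume volume) (q : (EuclideanSpace ℝ (Fin 2))) :
    ((fderiv ℝ (fun q => deriv (fun r => G r q) 0) q (EuclideanSpace.single (0 : Fin 2) (1 : ℝ))) 0 + (fderiv ℝ (fun q => deriv (fun r => G r q) 0) q (EuclideanSpace.single (1 : Fin 2) (1 : ℝ))) 1) = 0 := by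
  set Φ : ℝ × (EuclideanSpace ℝ (Fin 2)) → (EuclideanSpace ℝ (Fin 2)) := fun x => G x.1 x.2 with hΦ
  -- the r-derivative everywhere
  set dG : ℝ → (EuclideanSpace ℝ (Fin 2)) → (EuclideanSpace ℝ (Fin 2)) := fun r q => fderiv ℝ Φ (r, q) (1, 0) with hdG
  have hdG_cont : Continuous (fun x : ℝ × (EuclideanSpace ℝ (Fin 2)) => dG x.1 x.2) := by
    have : Continuous (fderiv ℝ Φ) := hG.continuous_fderiv (by norm_num)
    exact (this.clm_apply continuous_const)
  have hdG_zero : ∀ r q, 1 ≤ ‖q‖ → dG r q = 0 := by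
    intro r q hq
    have h1 : HasDerivAt (fun s => G s q) (dG r q) r := hasDerivAt_family hG r q
    have h2 : HasDerivAt (fun s => G s q) 0 r := by
      have : (fun s => G s q) = fun _ => q := funext fun s => hfix s q hq
      rw [this]; exact hasDerivAt_const r q
    exact h1.unique h2
  have hY : ContDiff ℝ 1 ((fun q => deriv (fun r => G r q) 0)) := contDiff_vel hG
  have hYc : Continuous ((fun q => deriv (fun r => G r q) 0)) := hY.continuous
  have hYd : Differentiable ℝ ((fun q => deriv (fun r => G r q) 0)) := hY.differentiable one_ne_zero
  have hY0 : ∀ q, deriv (fun r => G r q) 0 = dG 0 q := fun q => vel_eq hG q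
  -- Step W: for every smooth compactly supported φ, ∫ (fderiv φ q) (Y q) = 0
  have weak : ∀ φ : (EuclideanSpace ℝ (Fin 2)) → ℝ, ContDiff ℝ 2 φ → HasCompactSupport φ →
      ∫ q, fderiv ℝ φ q (deriv (fun r => G r q) 0) = 0 := by
    intro φ hφ hφs
    have hφc : Continuous φ := hφ.continuous
    have hφd : Differentiable ℝ φ := hφ.differentiable (by norm_num)
    have hφ'c : Continuous (fderiv ℝ φ) := hφ.continuous_fderiv (by norm_num)
    -- (W1) the integral is constant in r
    have hconst : ∀ r, ∫ q, φ (G r q) = ∫ q, φ q := by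
      intro r
      have hmeas : AEMeasurable (G r) volume := (hmp r).measurable.aemeasurable
      have := MeasureTheory.integral_map hmeas (f := φ) hφc.aestronglyMeasurable
      rw [(hmp r).map_eq] at this
      exact this.symm
    -- (W2) differentiate under the integral sign at r = 0
    set F : ℝ → (EuclideanSpace ℝ (Fin 2)) → ℝ := fun r q => φ (G r q) with hF
    set F' : ℝ → (EuclideanSpace ℝ (Fin 2)) → ℝ := fun r q => fderiv ℝ φ (G r q) (dG r q) with hF'
    have hGr_cont : ∀ r, Continuous (G r) := fun r =>
      hG.continuous.comp (continuous_const.prodMk continuous_id)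
    have hF'_cont : Continuous (fun x : ℝ × (EuclideanSpace ℝ (Fin 2)) => F' x.1 x.2) := by
      have hGc : Continuous Φ := hG.continuous
      have h1 : Continuous (fun x : ℝ × (EuclideanSpace ℝ (Fin 2)) => fderiv ℝ φ (G x.1 x.2)) := hφ'c.comp hGc
      exact h1.clm_apply hdG_cont
    obtain ⟨C, hC⟩ : ∃ C, ∀ x ∈ (Icc (-1 : ℝ) 1) ×ˢ (closedBall (0 : (EuclideanSpace ℝ (Fin 2))) 1),
        ‖(fun x : ℝ × (EuclideanSpace ℝ (Fin 2)) => F' x.1 x.2) x‖ ≤ C :=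
      (isCompact_Icc.prod (isCompact_closedBall 0 1)).exists_bound_of_continuousOn
        hF'_cont.continuousOn
    have hC0 : 0 ≤ C := le_trans (norm_nonneg _) (hC ((0 : ℝ), (0 : (EuclideanSpace ℝ (Fin 2))))
      ⟨⟨by norm_num, by norm_num⟩, mem_closedBall_self zero_le_one⟩)
    set bound : (EuclideanSpace ℝ (Fin 2)) → ℝ := (closedBall (0 : (EuclideanSpace ℝ (Fin 2))) 1).indicator (fun _ => C) with hbound
    have hbound_int : Integrable bound volume := by
      rw [hbound]
      exact (integrableOn_const (measure_closedBall_lt_top (x := (0 : (EuclideanSpace ℝ (Fin 2)))) (r := 1)).ne).integrable_indicator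
        measurableSet_closedBall
    have hderiv_F : ∀ q r, HasDerivAt (fun r => F r q) (F' r q) r := by
      intro q r
      have h1 : HasDerivAt (fun s => G s q) (dG r q) r := hasDerivAt_family hG r q
      exact (hφd (G r q)).hasFDerivAt.comp_hasDerivAt r h1
    have key := hasDerivAt_integral_of_dominated_loc_of_deriv_le (μ := (volume : Measure (EuclideanSpace ℝ (Fin 2))))
      (F := F) (F' := F') (x₀ := (0 : ℝ)) (s := Icc (-1 : ℝ) 1) (bound := bound)
      (Icc_mem_nhds (by norm_num) (by norm_num))
      (Eventually.of_forall fun r => (hφc.comp (hGr_cont r)).aestronglyMeasurable)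
      (by
        have : F 0 = φ := funext fun q => by simp [hF, h0]
        rw [this]; exact hφc.integrable_of_hasCompactSupport hφs)
      ((hF'_cont.comp (continuous_const.prodMk continuous_id)).aestronglyMeasurable)
      (Eventually.of_forall fun q r hr => by
        by_cases hq : q ∈ closedBall (0 : (EuclideanSpace ℝ (Fin 2))) 1
        · rw [hbound, indicator_of_mem hq]
          exact hC (r, q) ⟨hr, hq⟩
        · rw [hbound, indicator_of_notMem hq]
          have hq' : 1 ≤ ‖q‖ := by
            rw [mem_closedBall_zero_iff, not_le] at hq; exact hq.le
          simp [hF', hdG_zero r q hq'])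
      hbound_int
      (Eventually.of_forall fun q r _ => hderiv_F q r)
    -- (W3) the derivative is zero since the integral is constant
    have hI0 : HasDerivAt (fun r => ∫ q, F r q) 0 0 := by
      have : (fun r => ∫ q, F r q) = fun _ => ∫ q, φ q := funext fun r => hconst r
      rw [this]; exact hasDerivAt_const _ _
    have hval : ∫ q, F' 0 q = 0 := by
      have := key.2.unique hI0
      exact this
    have : (fun q => F' 0 q) = fun q => fderiv ℝ φ q (deriv (fun r => G r q) 0) := by
      funext q; simp [hF', h0, hY0]
    rw [this] at hval
    exact hval
  -- Step IBP: ∫ φ * div Y = 0 for every smooth compactly supported φ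
  have ibp : ∀ φ : (EuclideanSpace ℝ (Fin 2)) → ℝ, ContDiff ℝ 2 φ → HasCompactSupport φ →
      ∫ q, φ q * ((fderiv ℝ (fun q => deriv (fun r => G r q) 0) q (EuclideanSpace.single (0 : Fin 2) (1 : ℝ))) 0 + (fderiv ℝ (fun q => deriv (fun r => G r q) 0) q (EuclideanSpace.single (1 : Fin 2) (1 : ℝ))) 1) = 0 := by
    intro φ hφ hφs
    have hφc : Continuous φ := hφ.continuous
    have hφd : Differentiable ℝ φ := hφ.differentiable (by norm_num)
    have hφ'c : Continuous (fderiv ℝ φ) := hφ.continuous_fderiv (by norm_num)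
    -- components of Y and their partial derivatives
    set Y := (fun q => deriv (fun r => G r q) 0) with hYdef
    have hYi_d : ∀ i : Fin 2, ∀ q, HasLineDerivAt ℝ (fun q => Y q i) ((fderiv ℝ Y q (EuclideanSpace.single i 1)) i) q
        (EuclideanSpace.single i 1) := by
      intro i q
      have h1 : HasFDerivAt (fun q => Y q i) ((EuclideanSpace.proj i).comp (fderiv ℝ Y q)) q :=
        (EuclideanSpace.proj (𝕜 := ℝ) i).hasFDerivAt.comp q (hYd q).hasFDerivAt
      exact h1.hasLineDerivAt _
    have hφ_d : ∀ v q, HasLineDerivAt ℝ φ (fderiv ℝ φ q v) q v := fun v q =>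
      (hφd q).hasFDerivAt.hasLineDerivAt v
    have hcomp_cont : ∀ i : Fin 2, Continuous fun q => Y q i := fun i =>
      (EuclideanSpace.proj (𝕜 := ℝ) i).continuous.comp hYc
    have hder_cont : ∀ (i : Fin 2) (v : (EuclideanSpace ℝ (Fin 2))), Continuous fun q => (fderiv ℝ Y q v) i := fun i v =>
      (EuclideanSpace.proj (𝕜 := ℝ) i).continuous.comp ((hY.continuous_fderiv one_ne_zero).clm_apply continuous_const)
    have hφv_cont : ∀ v : (EuclideanSpace ℝ (Fin 2)), Continuous fun q => fderiv ℝ φ q v := fun v =>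
      hφ'c.clm_apply continuous_const
    have hφv_supp : ∀ v : (EuclideanSpace ℝ (Fin 2)), HasCompactSupport fun q => fderiv ℝ φ q v := fun v =>
      (hφs.fderiv_apply (𝕜 := ℝ) v)
    -- integration by parts in direction e_i
    have ibp_i : ∀ i : Fin 2,
        ∫ q, (Y q i) * (fderiv ℝ φ q (EuclideanSpace.single i 1)) =
          - ∫ q, ((fderiv ℝ Y q (EuclideanSpace.single i 1)) i) * φ q := by
      intro i
      have := integral_bilinear_hasLineDerivAt_right_eq_neg_left_of_integrable
        (μ := (volume : Measure (EuclideanSpace ℝ (Fin 2)))) (B := ContinuousLinearMap.mul ℝ ℝ)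
        (f := fun q => Y q i) (f' := fun q => (fderiv ℝ Y q (EuclideanSpace.single i 1)) i)
        (g := φ) (g' := fun q => fderiv ℝ φ q (EuclideanSpace.single i 1))
        (v := EuclideanSpace.single i 1)
        (((hder_cont i _).mul hφc).integrable_of_hasCompactSupport (hφs.mul_left))
        (((hcomp_cont i).mul (hφv_cont _)).integrable_of_hasCompactSupport
            ((hφv_supp _).mul_left))
        (((hcomp_cont i).mul hφc).integrable_of_hasCompactSupport (hφs.mul_left))
        (fun q _ => hYi_d i q) (fun q _ => hφ_d _ q)
      simpa using this
    -- expand fderiv φ q (Y q) on the basis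
    have hexp : ∀ q, fderiv ℝ φ q (Y q) =
        (Y q 0) * fderiv ℝ φ q (EuclideanSpace.single 0 1) + (Y q 1) * fderiv ℝ φ q (EuclideanSpace.single 1 1) := by
      intro q
      conv_lhs => rw [repr2 (Y q)]
      simp [map_add, map_smul, smul_eq_mul]
    have hw := weak φ hφ hφs
    change (∫ q, fderiv ℝ φ q (Y q)) = 0 at hw
    simp_rw [hexp] at hw
    rw [MeasureTheory.integral_add] at hw
    · rw [ibp_i 0, ibp_i 1] at hw
      have : ∫ q, φ q * ((fderiv ℝ Y q (EuclideanSpace.single (0 : Fin 2) (1 : ℝ))) 0 + (fderiv ℝ Y q (EuclideanSpace.single (1 : Fin 2) (1 : ℝ))) 1) =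
          (∫ q, ((fderiv ℝ Y q (EuclideanSpace.single 0 1)) 0) * φ q) +
            ∫ q, ((fderiv ℝ Y q (EuclideanSpace.single 1 1)) 1) * φ q := by
        rw [← MeasureTheory.integral_add]
        · congr 1; funext q; ring
        · exact ((hder_cont 0 _).mul hφc).integrable_of_hasCompactSupport (hφs.mul_left)
        · exact ((hder_cont 1 _).mul hφc).integrable_of_hasCompactSupport (hφs.mul_left)
      rw [this]; linarith
    · exact ((hcomp_cont 0).mul (hφv_cont _)).integrable_of_hasCompactSupport ((hφv_supp _).mul_left)
    · exact ((hcomp_cont 1).mul (hφv_cont _)).integrable_of_hasCompactSupport ((hφv_supp _).mul_left)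
  -- Step: fundamental lemma + continuity
  have hdivc : Continuous ((fun q => ((fderiv ℝ (fun q => deriv (fun r => G r q) 0) q (EuclideanSpace.single (0 : Fin 2) (1 : ℝ))) 0 + (fderiv ℝ (fun q => deriv (fun r => G r q) 0) q (EuclideanSpace.single (1 : Fin 2) (1 : ℝ))) 1))) := by
    have h := (hY.continuous_fderiv one_ne_zero)
    exact ((EuclideanSpace.proj (𝕜 := ℝ) 0).continuous.comp (h.clm_apply continuous_const)).add
      ((EuclideanSpace.proj (𝕜 := ℝ) 1).continuous.comp (h.clm_apply continuous_const))
  have hae : ∀ᵐ q ∂(volume : Measure (EuclideanSpace ℝ (Fin 2))), ((fderiv ℝ (fun q => deriv (fun r => G r q) 0) q (EuclideanSpace.single (0 : Fin 2) (1 : ℝ))) 0 + (fderiv ℝ (fun q => deriv (fun r => G r q) 0) q (EuclideanSpace.single (1 : Fin 2) (1 : ℝ))) 1) = 0 := by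
    apply ae_eq_zero_of_integral_contDiff_smul_eq_zero hdivc.locallyIntegrable
    intro g hg hgs
    have := ibp g (hg.of_le (by norm_cast)) hgs
    simpa [smul_eq_mul] using this
  have hfun : (fun q => ((fderiv ℝ (fun q => deriv (fun r => G r q) 0) q (EuclideanSpace.single (0 : Fin 2) (1 : ℝ))) 0 + (fderiv ℝ (fun q => deriv (fun r => G r q) 0) q (EuclideanSpace.single (1 : Fin 2) (1 : ℝ))) 1)) = fun _ => 0 := by
    have := (Continuous.ae_eq_iff_eq (μ := (volume : Measure (EuclideanSpace ℝ (Fin 2)))) hdivc continuous_const).1 hae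
    exact this
  exact congrFun hfun q

end



/-- **Stream-function lemma**: a `C¹` planar field `(u, v)` with `∂ₓu + ∂_y v = 0` vanishing off the open unit disc vanishes somewhere inside it (`h(x,y) = ∫_{-2}^{y} u(x,t) dt` has `h_y = u`, `h_x = -v`, `h = 0` off the disc; interior extremum). [folklore] -/
theorem planar_divFree_zero (u v ux vy : ℝ → ℝ → ℝ)
    (hu : Continuous (Function.uncurry u))
    (hux : Continuous (Function.uncurry ux)) (hvy : Continuous (Function.uncurry vy))
    (hdu : ∀ x y, HasDerivAt (fun s => u s y) (ux x y) x)
    (hdv : ∀ x y, HasDerivAt (fun t => v x t) (vy x y) y)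
    (hdiv : ∀ x y, ux x y + vy x y = 0)
    (hu0 : ∀ x y, 1 ≤ x ^ 2 + y ^ 2 → u x y = 0)
    (hv0 : ∀ x y, 1 ≤ x ^ 2 + y ^ 2 → v x y = 0) :
    ∃ x y, x ^ 2 + y ^ 2 < 1 ∧ u x y = 0 ∧ v x y = 0 := by
  -- continuity in each variable separately
  have hu_x : ∀ x, Continuous (u x) := fun x =>
    hu.comp (continuous_const.prodMk continuous_id)
  have hux_x : ∀ x, Continuous (ux x) := fun x =>
    hux.comp (continuous_const.prodMk continuous_id)
  have hvy_x : ∀ x, Continuous (vy x) := fun x =>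
    hvy.comp (continuous_const.prodMk continuous_id)
  -- the stream function `h x y = ∫_{-2}^{y} u x t dt`
  set h : ℝ → ℝ → ℝ := fun x y => ∫ t in (-2 : ℝ)..y, u x t with hh
  -- (S1) ∂h/∂y = u
  have S1 : ∀ x y, HasDerivAt (fun y => h x y) (u x y) y := by
    intro x y
    exact intervalIntegral.integral_hasDerivAt_right ((hu_x x).intervalIntegrable _ _)
      ((hu_x x).stronglyMeasurableAtFilter _ _) (hu_x x).continuousAt
  -- (S2a) ∂/∂x ∫_{-2}^{b} u x t dt = ∫_{-2}^{b} ux x t dt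
  have S2a : ∀ b x₀, HasDerivAt (fun x => ∫ t in (-2 : ℝ)..b, u x t)
      (∫ t in (-2 : ℝ)..b, ux x₀ t) x₀ := by
    intro b x₀
    -- uniform bound of `ux` on `[x₀-1, x₀+1] × uIcc (-2) b`
    obtain ⟨C, hC⟩ : ∃ C, ∀ p ∈ (Icc (x₀ - 1) (x₀ + 1)) ×ˢ (uIcc (-2 : ℝ) b),
        ‖Function.uncurry ux p‖ ≤ C :=
      ((isCompact_Icc.prod isCompact_uIcc).exists_bound_of_continuousOn hux.continuousOn)
    have key := intervalIntegral.hasDerivAt_integral_of_dominated_loc_of_deriv_le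
      (μ := volume) (a := (-2 : ℝ)) (b := b) (F := fun x t => u x t) (F' := fun x t => ux x t)
      (x₀ := x₀) (s := Icc (x₀ - 1) (x₀ + 1)) (bound := fun _ => C)
      (Icc_mem_nhds (by linarith) (by linarith))
      (Eventually.of_forall fun x => (hu_x x).aestronglyMeasurable)
      ((hu_x x₀).intervalIntegrable _ _)
      ((hux_x x₀).aestronglyMeasurable)
      (Eventually.of_forall fun t ht x hx => hC (x, t) ⟨hx, uIoc_subset_uIcc ht⟩)
      intervalIntegrable_const
      (Eventually.of_forall fun t _ x _ => hdu x t)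
    exact key.2
  -- (S2) ∂h/∂x = -v
  have S2 : ∀ b x, HasDerivAt (fun x => ∫ t in (-2 : ℝ)..b, u x t) (-(v x b)) x := by
    intro b x
    have h1 : ∫ t in (-2 : ℝ)..b, ux x t = -(v x b) := by
      have h2 : ∫ t in (-2 : ℝ)..b, ux x t = ∫ t in (-2 : ℝ)..b, -(vy x t) :=
        intervalIntegral.integral_congr fun t _ => by
          have := hdiv x t; show ux x t = -(vy x t); linarith
      have h3 : ∫ t in (-2 : ℝ)..b, vy x t = v x b - v x (-2) :=
        intervalIntegral.integral_eq_sub_of_hasDerivAt (fun t _ => hdv x t)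
          ((hvy_x x).intervalIntegrable _ _)
      have h4 : v x (-2) = 0 := hv0 x (-2) (by nlinarith [sq_nonneg x])
      rw [h2, intervalIntegral.integral_neg, h3, h4, sub_zero]
    simpa [h1] using S2a b x
  -- (S3) zero flux through vertical lines
  have S3 : ∀ x, ∫ t in (-2 : ℝ)..2, u x t = 0 := by
    have hderiv : ∀ x, HasDerivAt (fun x => ∫ t in (-2 : ℝ)..2, u x t) 0 x := by
      intro x
      have := S2 2 x
      have h0 : v x 2 = 0 := hv0 x 2 (by nlinarith [sq_nonneg x])
      simpa [h0] using this
    have hconst := is_const_of_deriv_eq_zero (f := fun x => ∫ t in (-2 : ℝ)..2, u x t)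
      (fun x => (hderiv x).differentiableAt) (fun x => (hderiv x).deriv)
    intro x
    rw [hconst x 2]
    exact intervalIntegral.integral_zero_ae (Eventually.of_forall fun t _ =>
      hu0 2 t (by nlinarith [sq_nonneg t]))
  -- (S3') h vanishes off the open unit disc
  have hzero : ∀ x y, 1 ≤ x ^ 2 + y ^ 2 → h x y = 0 := by
    intro x y hxy
    simp only [hh]
    by_cases hy : y ≤ 0
    · apply intervalIntegral.integral_zero_ae (Eventually.of_forall fun t ht => hu0 x t ?_)
      rcases le_or_gt (-2 : ℝ) y with h2 | h2
      · rw [uIoc_of_le h2] at ht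
        nlinarith [ht.1, ht.2]
      · rw [uIoc_of_ge h2.le] at ht
        nlinarith [ht.1, ht.2]
    · push Not at hy
      by_cases hx : 1 ≤ x ^ 2
      · exact intervalIntegral.integral_zero_ae (Eventually.of_forall fun t _ =>
          hu0 x t (by nlinarith [sq_nonneg t]))
      · push Not at hx
        have hsplit : (∫ t in (-2 : ℝ)..y, u x t) + ∫ t in y..2, u x t = ∫ t in (-2 : ℝ)..2, u x t :=
          intervalIntegral.integral_add_adjacent_intervals ((hu_x x).intervalIntegrable _ _)
            ((hu_x x).intervalIntegrable _ _)
        have htail : ∫ t in y..2, u x t = 0 := by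
          apply intervalIntegral.integral_zero_ae (Eventually.of_forall fun t ht => hu0 x t ?_)
          rcases le_or_gt y 2 with h2 | h2
          · rw [uIoc_of_le h2] at ht
            nlinarith [ht.1, ht.2]
          · rw [uIoc_of_ge h2.le] at ht
            nlinarith [ht.1, ht.2]
        linarith [S3 x]
  -- (S4) joint continuity of the stream function
  have hcont : Continuous fun p : ℝ × ℝ => h p.1 p.2 :=
    intervalIntegral.continuous_parametric_primitive_of_continuous (a₀ := (-2 : ℝ)) hu
  -- (S5) extremum argument on the closed unit disc
  set K : Set (ℝ × ℝ) := {p | p.1 ^ 2 + p.2 ^ 2 ≤ 1} with hK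
  have hKc : IsCompact K := by
    apply Metric.isCompact_of_isClosed_isBounded
    · exact isClosed_le (by fun_prop) continuous_const
    · refine (Metric.isBounded_closedBall (x := (0 : ℝ × ℝ)) (r := 1)).subset ?_
      intro p hp
      simp only [hK, mem_setOf_eq] at hp
      rw [mem_closedBall_zero_iff, Prod.norm_def, max_le_iff, Real.norm_eq_abs,
        Real.norm_eq_abs, abs_le, abs_le]
      constructor <;> constructor <;> nlinarith [sq_nonneg p.1, sq_nonneg p.2]
  have hK0 : ((0 : ℝ), (0 : ℝ)) ∈ K := by simp [hK]
  obtain ⟨pM, hpMK, hpM⟩ := hKc.exists_isMaxOn ⟨_, hK0⟩ hcont.continuousOn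
  obtain ⟨pm, hpmK, hpm⟩ := hKc.exists_isMinOn ⟨_, hK0⟩ hcont.continuousOn
  -- helper: from a global extremum at an interior point, both components vanish
  have hglobmax : 0 < h pM.1 pM.2 → ∀ p : ℝ × ℝ, h p.1 p.2 ≤ h pM.1 pM.2 := by
    intro hpos p
    by_cases hp : p ∈ K
    · exact hpM hp
    · have : 1 ≤ p.1 ^ 2 + p.2 ^ 2 := by
        simp only [hK, mem_setOf_eq, not_le] at hp; exact hp.le
      rw [hzero p.1 p.2 this]; exact hpos.le
  have hglobmin : h pm.1 pm.2 < 0 → ∀ p : ℝ × ℝ, h pm.1 pm.2 ≤ h p.1 p.2 := by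
    intro hneg p
    by_cases hp : p ∈ K
    · exact hpm hp
    · have : 1 ≤ p.1 ^ 2 + p.2 ^ 2 := by
        simp only [hK, mem_setOf_eq, not_le] at hp; exact hp.le
      rw [hzero p.1 p.2 this]; exact hneg.le
  by_cases hpos : 0 < h pM.1 pM.2
  · -- Case A: positive maximum, attained inside the open disc
    have hin : pM.1 ^ 2 + pM.2 ^ 2 < 1 := by
      by_contra hc; push Not at hc
      have := hzero pM.1 pM.2 hc; linarith
    have hmax := hglobmax hpos
    have hlm1 : IsLocalMax (fun y => h pM.1 y) pM.2 :=
      Filter.Eventually.of_forall fun y => hmax (pM.1, y)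
    have hlm2 : IsLocalMax (fun x => h x pM.2) pM.1 :=
      Filter.Eventually.of_forall fun x => hmax (x, pM.2)
    have h1 : u pM.1 pM.2 = 0 := hlm1.hasDerivAt_eq_zero (S1 pM.1 pM.2)
    have h2 : -(v pM.1 pM.2) = 0 := hlm2.hasDerivAt_eq_zero (S2 pM.2 pM.1)
    exact ⟨pM.1, pM.2, hin, h1, by linarith⟩
  by_cases hneg : h pm.1 pm.2 < 0
  · -- Case B: negative minimum, attained inside the open disc
    have hin : pm.1 ^ 2 + pm.2 ^ 2 < 1 := by
      by_contra hc; push Not at hc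
      have := hzero pm.1 pm.2 hc; linarith
    have hmin := hglobmin hneg
    have hlm1 : IsLocalMin (fun y => h pm.1 y) pm.2 :=
      Filter.Eventually.of_forall fun y => hmin (pm.1, y)
    have hlm2 : IsLocalMin (fun x => h x pm.2) pm.1 :=
      Filter.Eventually.of_forall fun x => hmin (x, pm.2)
    have h1 : u pm.1 pm.2 = 0 := hlm1.hasDerivAt_eq_zero (S1 pm.1 pm.2)
    have h2 : -(v pm.1 pm.2) = 0 := hlm2.hasDerivAt_eq_zero (S2 pm.2 pm.1)
    exact ⟨pm.1, pm.2, hin, h1, by linarith⟩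
  · -- Case C: h ≡ 0
    push Not at hpos hneg
    have hall : ∀ x y, h x y = 0 := by
      intro x y
      by_cases hp : (x, y) ∈ K
      · have a1 : h x y ≤ h pM.1 pM.2 := hpM hp
        have a2 : h pm.1 pm.2 ≤ h x y := hpm hp
        linarith
      · have : 1 ≤ x ^ 2 + y ^ 2 := by
          simp only [hK, mem_setOf_eq, not_le] at hp; exact hp.le
        exact hzero x y this
    have hu00 : u 0 0 = 0 := by
      have h1 := S1 0 0
      have h2 : HasDerivAt (fun y => h 0 y) 0 0 := by
        have : (fun y => h 0 y) = fun _ => 0 := funext fun y => hall 0 y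
        rw [this]; exact hasDerivAt_const _ _
      exact h1.unique h2
    have hv00 : v 0 0 = 0 := by
      have h1 := S2 0 0
      have h2 : HasDerivAt (fun x => ∫ t in (-2 : ℝ)..0, u x t) 0 0 := by
        have : (fun x => ∫ t in (-2 : ℝ)..0, u x t) = fun _ => 0 := funext fun x => hall x 0
        rw [this]; exact hasDerivAt_const _ _
      have := h1.unique h2
      linarith
    exact ⟨0, 0, by norm_num, hu00, hv00⟩


/-! ### Bridge: a zero of the velocity field inside the disc -/

section Bridge



/-- First coordinate of the point `x e₀ + y e₁`. [folklore] -/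
theorem pt_apply_zero (x y : ℝ) : ((x : ℝ) • (EuclideanSpace.single (0 : Fin 2) (1 : ℝ)) + (y : ℝ) • (EuclideanSpace.single (1 : Fin 2) (1 : ℝ))) 0 = x := by simp
/-- Second coordinate of the point `x e₀ + y e₁`. [folklore] -/
theorem pt_apply_one (x y : ℝ) : ((x : ℝ) • (EuclideanSpace.single (0 : Fin 2) (1 : ℝ)) + (y : ℝ) • (EuclideanSpace.single (1 : Fin 2) (1 : ℝ))) 1 = y := by simp

/-- `‖x e₀ + y e₁‖² = x² + y²`. [folklore] -/
theorem norm_pt_sq (x y : ℝ) : ‖((x : ℝ) • (EuclideanSpace.single (0 : Fin 2) (1 : ℝ)) + (y : ℝ) • (EuclideanSpace.single (1 : Fin 2) (1 : ℝ)))‖ ^ 2 = x ^ 2 + y ^ 2 := by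
  rw [EuclideanSpace.norm_sq_eq, Fin.sum_univ_two, pt_apply_zero, pt_apply_one,
    Real.norm_eq_abs, Real.norm_eq_abs, sq_abs, sq_abs]

/-- `(x, y) ↦ x e₀ + y e₁` is continuous. [folklore] -/
theorem continuous_pt : Continuous fun p : ℝ × ℝ => ((p.1 : ℝ) • (EuclideanSpace.single (0 : Fin 2) (1 : ℝ)) + (p.2 : ℝ) • (EuclideanSpace.single (1 : Fin 2) (1 : ℝ))) :=
  (continuous_fst.smul continuous_const).add (continuous_snd.smul continuous_const)

/-- `∂/∂x (x e₀ + y e₁) = e₀`. [folklore] -/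
theorem hasDerivAt_pt_fst (x y : ℝ) : HasDerivAt (fun s => ((s : ℝ) • (EuclideanSpace.single (0 : Fin 2) (1 : ℝ)) + (y : ℝ) • (EuclideanSpace.single (1 : Fin 2) (1 : ℝ)))) (EuclideanSpace.single (0 : Fin 2) (1 : ℝ)) x := by
  have h := ((hasDerivAt_id x).smul_const (EuclideanSpace.single (0 : Fin 2) (1 : ℝ))).add_const (y • (EuclideanSpace.single (1 : Fin 2) (1 : ℝ)))
  simpa [one_smul] using h

/-- `∂/∂y (x e₀ + y e₁) = e₁`. [folklore] -/
theorem hasDerivAt_pt_snd (x y : ℝ) : HasDerivAt (fun t => ((x : ℝ) • (EuclideanSpace.single (0 : Fin 2) (1 : ℝ)) + (t : ℝ) • (EuclideanSpace.single (1 : Fin 2) (1 : ℝ)))) (EuclideanSpace.single (1 : Fin 2) (1 : ℝ)) y := by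
  have h := ((hasDerivAt_id y).smul_const (EuclideanSpace.single (1 : Fin 2) (1 : ℝ))).const_add (x • (EuclideanSpace.single (0 : Fin 2) (1 : ℝ)))
  simpa [one_smul] using h

variable {G : ℝ → (EuclideanSpace ℝ (Fin 2)) → (EuclideanSpace ℝ (Fin 2))}

/-- The velocity field of a family as in `div2_vel_eq_zero` has a zero in the open unit disc (transfer to coordinates and `planar_divFree_zero`). [folklore] -/
theorem exists_zero_vel (hG : ContDiff ℝ 2 (fun x : ℝ × (EuclideanSpace ℝ (Fin 2)) => G x.1 x.2))
    (h0 : ∀ q, G 0 q = q) (hfix : ∀ r q, 1 ≤ ‖q‖ → G r q = q)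
    (hmp : ∀ r, MeasurePreserving (G r) volume volume) :
    ∃ q : (EuclideanSpace ℝ (Fin 2)), ‖q‖ < 1 ∧ deriv (fun r => G r q) 0 = 0 := by
  set Y := (fun q => deriv (fun r => G r q) 0) with hYdef
  have hY : ContDiff ℝ 1 Y := contDiff_vel hG
  have hYc : Continuous Y := hY.continuous
  have hYd : Differentiable ℝ Y := hY.differentiable one_ne_zero
  have hY'c : Continuous (fderiv ℝ Y) := hY.continuous_fderiv one_ne_zero
  have hdiv0 : ∀ q, ((fderiv ℝ Y q (EuclideanSpace.single (0 : Fin 2) (1 : ℝ))) 0 + (fderiv ℝ Y q (EuclideanSpace.single (1 : Fin 2) (1 : ℝ))) 1) = 0 := fun q => div2_vel_eq_zero hG h0 hfix hmp q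
  have hYfix : ∀ q : (EuclideanSpace ℝ (Fin 2)), 1 ≤ ‖q‖ → Y q = 0 := fun q hq =>
    vel_eq_zero_of_fix (G := G) fun r => hfix r q hq
  -- planar data
  set u : ℝ → ℝ → ℝ := fun x y => Y (((x : ℝ) • (EuclideanSpace.single (0 : Fin 2) (1 : ℝ)) + (y : ℝ) • (EuclideanSpace.single (1 : Fin 2) (1 : ℝ)))) 0 with hu_def
  set v : ℝ → ℝ → ℝ := fun x y => Y (((x : ℝ) • (EuclideanSpace.single (0 : Fin 2) (1 : ℝ)) + (y : ℝ) • (EuclideanSpace.single (1 : Fin 2) (1 : ℝ)))) 1 with hv_def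
  set ux : ℝ → ℝ → ℝ := fun x y => (fderiv ℝ Y (((x : ℝ) • (EuclideanSpace.single (0 : Fin 2) (1 : ℝ)) + (y : ℝ) • (EuclideanSpace.single (1 : Fin 2) (1 : ℝ)))) (EuclideanSpace.single (0 : Fin 2) (1 : ℝ))) 0 with hux_def
  set vy : ℝ → ℝ → ℝ := fun x y => (fderiv ℝ Y (((x : ℝ) • (EuclideanSpace.single (0 : Fin 2) (1 : ℝ)) + (y : ℝ) • (EuclideanSpace.single (1 : Fin 2) (1 : ℝ)))) (EuclideanSpace.single (1 : Fin 2) (1 : ℝ))) 1 with hvy_def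
  have hproj_c : ∀ i : Fin 2, Continuous fun w : (EuclideanSpace ℝ (Fin 2)) => w i := fun i =>
    (EuclideanSpace.proj (𝕜 := ℝ) i).continuous
  have hu : Continuous (Function.uncurry u) :=
    (hproj_c 0).comp (hYc.comp continuous_pt)
  have hux : Continuous (Function.uncurry ux) :=
    (hproj_c 0).comp ((hY'c.comp continuous_pt).clm_apply continuous_const)
  have hvy : Continuous (Function.uncurry vy) :=
    (hproj_c 1).comp ((hY'c.comp continuous_pt).clm_apply continuous_const)
  have hdu : ∀ x y, HasDerivAt (fun s => u s y) (ux x y) x := by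
    intro x y
    have h1 := (hYd (((x : ℝ) • (EuclideanSpace.single (0 : Fin 2) (1 : ℝ)) + (y : ℝ) • (EuclideanSpace.single (1 : Fin 2) (1 : ℝ))))).hasFDerivAt.comp_hasDerivAt (f := fun s => ((s : ℝ) • (EuclideanSpace.single (0 : Fin 2) (1 : ℝ)) + (y : ℝ) • (EuclideanSpace.single (1 : Fin 2) (1 : ℝ)))) x
      (hasDerivAt_pt_fst x y)
    have h2 := (EuclideanSpace.proj (𝕜 := ℝ) (0 : Fin 2)).hasFDerivAt.comp_hasDerivAt
      (f := Y ∘ fun s => ((s : ℝ) • (EuclideanSpace.single (0 : Fin 2) (1 : ℝ)) + (y : ℝ) • (EuclideanSpace.single (1 : Fin 2) (1 : ℝ)))) x h1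
    simpa [Function.comp_def] using h2
  have hdv : ∀ x y, HasDerivAt (fun t => v x t) (vy x y) y := by
    intro x y
    have h1 := (hYd (((x : ℝ) • (EuclideanSpace.single (0 : Fin 2) (1 : ℝ)) + (y : ℝ) • (EuclideanSpace.single (1 : Fin 2) (1 : ℝ))))).hasFDerivAt.comp_hasDerivAt (f := fun t => ((x : ℝ) • (EuclideanSpace.single (0 : Fin 2) (1 : ℝ)) + (t : ℝ) • (EuclideanSpace.single (1 : Fin 2) (1 : ℝ)))) y
      (hasDerivAt_pt_snd x y)
    have h2 := (EuclideanSpace.proj (𝕜 := ℝ) (1 : Fin 2)).hasFDerivAt.comp_hasDerivAt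
      (f := Y ∘ fun t => ((x : ℝ) • (EuclideanSpace.single (0 : Fin 2) (1 : ℝ)) + (t : ℝ) • (EuclideanSpace.single (1 : Fin 2) (1 : ℝ)))) y h1
    simpa [Function.comp_def] using h2
  have hdiv : ∀ x y, ux x y + vy x y = 0 := fun x y => hdiv0 (((x : ℝ) • (EuclideanSpace.single (0 : Fin 2) (1 : ℝ)) + (y : ℝ) • (EuclideanSpace.single (1 : Fin 2) (1 : ℝ))))
  have hnorm : ∀ x y, 1 ≤ x ^ 2 + y ^ 2 → 1 ≤ ‖((x : ℝ) • (EuclideanSpace.single (0 : Fin 2) (1 : ℝ)) + (y : ℝ) • (EuclideanSpace.single (1 : Fin 2) (1 : ℝ)))‖ := by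
    intro x y hxy
    have h := norm_pt_sq x y
    nlinarith [norm_nonneg (((x : ℝ) • (EuclideanSpace.single (0 : Fin 2) (1 : ℝ)) + (y : ℝ) • (EuclideanSpace.single (1 : Fin 2) (1 : ℝ))))]
  have hu0 : ∀ x y, 1 ≤ x ^ 2 + y ^ 2 → u x y = 0 := fun x y hxy => by
    simp [hu_def, hYfix _ (hnorm x y hxy)]
  have hv0 : ∀ x y, 1 ≤ x ^ 2 + y ^ 2 → v x y = 0 := fun x y hxy => by
    simp [hv_def, hYfix _ (hnorm x y hxy)]
  obtain ⟨x, y, hxy, hux0, hvy0⟩ := planar_divFree_zero u v ux vy hu hux hvy hdu hdv hdiv hu0 hv0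
  refine ⟨((x : ℝ) • (EuclideanSpace.single (0 : Fin 2) (1 : ℝ)) + (y : ℝ) • (EuclideanSpace.single (1 : Fin 2) (1 : ℝ))), ?_, ?_⟩
  · have h := norm_pt_sq x y
    nlinarith [norm_nonneg (((x : ℝ) • (EuclideanSpace.single (0 : Fin 2) (1 : ℝ)) + (y : ℝ) • (EuclideanSpace.single (1 : Fin 2) (1 : ℝ))))]
  · show Y (((x : ℝ) • (EuclideanSpace.single (0 : Fin 2) (1 : ℝ)) + (y : ℝ) • (EuclideanSpace.single (1 : Fin 2) (1 : ℝ)))) = 0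
    rw [repr2 (Y (((x : ℝ) • (EuclideanSpace.single (0 : Fin 2) (1 : ℝ)) + (y : ℝ) • (EuclideanSpace.single (1 : Fin 2) (1 : ℝ)))))]
    have a : Y (((x : ℝ) • (EuclideanSpace.single (0 : Fin 2) (1 : ℝ)) + (y : ℝ) • (EuclideanSpace.single (1 : Fin 2) (1 : ℝ)))) 0 = 0 := hux0
    have b : Y (((x : ℝ) • (EuclideanSpace.single (0 : Fin 2) (1 : ℝ)) + (y : ℝ) • (EuclideanSpace.single (1 : Fin 2) (1 : ℝ)))) 1 = 0 := hvy0
    rw [a, b, zero_smul, zero_smul, add_zero]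

/-- A linear map `ℝ × ℝ → ℝ²` killing `(1, 0)` is not onto. [folklore] -/
theorem not_surjective_of_apply_inl_eq_zero (L : ℝ × ℝ →L[ℝ] (EuclideanSpace ℝ (Fin 2))) (hL : L (1, 0) = 0) :
    ¬ Function.Surjective L := by
  intro hs
  set w : (EuclideanSpace ℝ (Fin 2)) := L (0, 1) with hw
  have hz : ∀ z : ℝ × ℝ, L z = z.2 • w := by
    intro z
    have hrepr : z = z.1 • ((1 : ℝ), (0 : ℝ)) + z.2 • ((0 : ℝ), (1 : ℝ)) := by ext <;> simp
    calc L z = L (z.1 • ((1 : ℝ), (0 : ℝ)) + z.2 • ((0 : ℝ), (1 : ℝ))) := congrArg L hrepr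
      _ = z.2 • w := by rw [map_add, map_smul, map_smul, hL, smul_zero, zero_add]
  obtain ⟨a, ha⟩ := hs (EuclideanSpace.single (0 : Fin 2) (1 : ℝ))
  obtain ⟨b, hb⟩ := hs (EuclideanSpace.single (1 : Fin 2) (1 : ℝ))
  rw [hz] at ha hb
  have h00 : a.2 * w 0 = 1 := by simpa using congrArg (fun u : (EuclideanSpace ℝ (Fin 2)) => u 0) ha
  have h01 : a.2 * w 1 = 0 := by simpa using congrArg (fun u : (EuclideanSpace ℝ (Fin 2)) => u 1) ha
  have h11 : b.2 * w 1 = 1 := by simpa using congrArg (fun u : (EuclideanSpace ℝ (Fin 2)) => u 1) hb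
  have ha2 : a.2 ≠ 0 := by
    rintro h; rw [h, zero_mul] at h00; exact zero_ne_one h00
  have hw1 : w 1 = 0 := by
    rcases mul_eq_zero.1 h01 with h | h
    · exact absurd h ha2
    · exact h
  rw [hw1, mul_zero] at h11
  exact zero_ne_one h11

end Bridge

/-! ### The die: the pair-plaque map is nowhere-in-(θ,θ′) a submersion for every p -/

section Die



variable (D : AnosovDie)

/-- For every pair of rotor states of an Anosov die there is a point of the open Lambert disc at which the pair-plaque map `(r, r′) ↦ F(W θ r, W θ′ r′)(p)` is not a submersion at `0`: its `r`-partial is the velocity of the area-preserving family `r ↦ F(W θ r, θ′) ∘ F(θ, θ′)⁻¹`, which has a zero in the disc. [folklore] -/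
theorem exists_not_surjective_fderiv_pairPlaqueMap (θ θ' : D.K) :
    ∃ p ∈ ball (0 : (EuclideanSpace ℝ (Fin 2))) 1, ¬ Function.Surjective (fderiv ℝ (D.pairPlaqueMap θ θ' p) 0) := by
  -- the one-parameter family `A r = F(W θ r, θ′)`, the inverse `S = F(θ,θ′)⁻¹`, and `G r = A r ∘ S`
  set A : ℝ → (EuclideanSpace ℝ (Fin 2)) → (EuclideanSpace ℝ (Fin 2)) := fun r p => D.die (D.plaque θ r) (D.plaque θ' 0) p with hA
  set S : (EuclideanSpace ℝ (Fin 2)) → (EuclideanSpace ℝ (Fin 2)) := fun q => (D.die θ θ').symm q with hS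
  set G : ℝ → (EuclideanSpace ℝ (Fin 2)) → (EuclideanSpace ℝ (Fin 2)) := fun r q => A r (S q) with hG
  have hAinf : ContDiff ℝ ∞ (fun x : ℝ × ℝ × (EuclideanSpace ℝ (Fin 2)) => D.die (D.plaque θ x.1) (D.plaque θ' x.2.1) x.2.2) :=
    D.contDiff_die_plaque θ θ'
  have hSinf : ContDiff ℝ ∞ S := by
    have : S = fun q => -(D.die (D.rev θ) (D.rev θ') (-q)) := funext fun q => D.die_symm_apply θ θ' q
    rw [this]
    exact ((D.contDiff_die _ _).comp contDiff_neg).neg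
  have hGs : ContDiff ℝ 2 (fun x : ℝ × (EuclideanSpace ℝ (Fin 2)) => G x.1 x.2) := by
    have h1 : ContDiff ℝ ∞ (fun x : ℝ × (EuclideanSpace ℝ (Fin 2)) => ((x.1, (0 : ℝ), S x.2) : ℝ × ℝ × (EuclideanSpace ℝ (Fin 2)))) :=
      contDiff_fst.prodMk (contDiff_const.prodMk (hSinf.comp contDiff_snd))
    exact (hAinf.comp h1).of_le (by norm_cast)
  have h0 : ∀ q, G 0 q = q := fun q => by
    simp [hG, hA, hS, D.plaque_zero]
  have hfix : ∀ r q, 1 ≤ ‖q‖ → G r q = q := by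
    intro r q hq
    have h1 : S q = q := D.die_symm_apply_of_one_le θ θ' hq
    simp only [hG, hA, h1]
    exact D.die_apply_of_one_le _ _ q hq
  -- measure preservation of `G r`
  let eM : (EuclideanSpace ℝ (Fin 2)) ≃ᵐ (EuclideanSpace ℝ (Fin 2)) :=
    { toEquiv := D.die θ θ'
      measurable_toFun := D.measurable_die_apply θ θ'
      measurable_invFun := D.measurable_die_symm θ θ' }
  have hSmp : MeasurePreserving S volume volume := by
    have h := (D.measurePreserving_die θ θ').symm eM
    exact h
  have hmp : ∀ r, MeasurePreserving (G r) volume volume := fun r =>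
    (D.measurePreserving_die (D.plaque θ r) (D.plaque θ' 0)).comp hSmp
  -- a zero of the velocity field inside the disc
  obtain ⟨q, hq, hYq⟩ := exists_zero_vel hGs h0 hfix hmp
  -- the witness point
  refine ⟨S q, ?_, ?_⟩
  · rw [mem_ball_zero_iff]
    by_contra hc
    have h1 : 1 ≤ ‖S q‖ := (not_lt.mp hc)
    have h2 : D.die θ θ' (S q) = S q := D.die_apply_of_one_le θ θ' _ h1
    have h3 : D.die θ θ' (S q) = q := by simp [hS]
    rw [h3] at h2
    rw [← h2] at h1
    exact (not_lt.mpr h1) hq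
  · apply not_surjective_of_apply_inl_eq_zero
    -- the `r`-partial of the pair-plaque map at `S q` is the velocity of `G` at `q`
    have hd1 : HasDerivAt (fun s => D.pairPlaqueMap θ θ' (S q) ((s, 0) : ℝ × ℝ))
        (fderiv ℝ (D.pairPlaqueMap θ θ' (S q)) 0 (1, 0)) 0 := by
      have hdiff : DifferentiableAt ℝ (D.pairPlaqueMap θ θ' (S q)) (0 : ℝ × ℝ) :=
        ((D.contDiff_pairPlaqueMap θ θ' (S q)).differentiable (by norm_cast)).differentiableAt
      have hc : HasDerivAt (fun s : ℝ => ((s, 0) : ℝ × ℝ)) ((1 : ℝ), (0 : ℝ)) 0 := by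
        refine HasDerivAt.prodMk (hasDerivAt_id 0) (hasDerivAt_const 0 (0 : ℝ)) |>.congr_deriv ?_
        simp
      have := hdiff.hasFDerivAt.comp_hasDerivAt (f := fun s : ℝ => ((s, 0) : ℝ × ℝ)) (0 : ℝ) hc
      simpa [Function.comp_def] using this
    have hd2 : HasDerivAt (fun s => G s q) (deriv (fun r => G r q) 0) 0 := by
      rw [vel_eq hGs q]
      exact hasDerivAt_family hGs 0 q
    have hfun : (fun s => D.pairPlaqueMap θ θ' (S q) ((s, 0) : ℝ × ℝ)) = fun s => G s q := by
      funext s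
      simp [hG, hA, AnosovDie.pairPlaqueMap, D.plaque_zero]
    rw [hfun] at hd1
    rw [hd1.unique hd2]
    exact hYq

end Die


end AnosovDie.PairPlaqueObstruction

/-- **No Anosov die is pair-plaque submersive**: the predicate `IsPairPlaqueSubmersive` (submersion
for a.e. `(θ, θ′)` and EVERY `p` in the open disc) fails for every `D : AnosovDie`, because for
every `(θ, θ′)` the divergence-free velocity field of `r ↦ F(W θ r, θ′) ∘ F(θ, θ′)⁻¹` has a zero in
the open disc (`PairPlaqueObstruction.exists_not_surjective_fderiv_pairPlaqueMap`) and `m ⊗ m ≠ 0`.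
[folklore] -/
theorem AnosovDie.not_isPairPlaqueSubmersive (D : AnosovDie) : ¬ D.IsPairPlaqueSubmersive := by
  intro hsub
  have hfalse : ∀ᵐ q ∂(D.m.prod D.m), False := by
    filter_upwards [hsub] with q hq
    obtain ⟨p, hp, hns⟩ := AnosovDie.PairPlaqueObstruction.exists_not_surjective_fderiv_pairPlaqueMap D q.1 q.2
    exact hns (hq p hp)
  rw [Filter.eventually_false_iff_eq_bot, ae_eq_bot] at hfalse
  exact (IsProbabilityMeasure.ne_zero (D.m.prod D.m)) hfalse

end Literature.Dynamics.Hyperbolic
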